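import Summits.AtomisticToContinuum.HydrodynamicLimit.Theorems.ImplosionDichotomyPolynomialCompressionIsentropicCalculus

/-!
# Isentropic reference calculus, second order: `∂ₗ∂ᵢρ₁`, `∂ₗ∂ᵢθ₁` through `c₁ = ρ₁^{1/3}`

Helper file for the line `log-lipschitz-budget` of the crux `ImplosionDichotomy.PolynomialCompression`
(stmt-AtomisticToContinuum-12587), stub `stub_logBudgetShadowing` (levels `k ≥ 1` of the energy method
meet SECOND derivatives of the reference; as at first order everything is polynomial in the cube root):
`∂ₗ∂ᵢρ = 6 c ∂ₗc ∂ᵢc + 3 c² ∂ₗ∂ᵢc` and, for an isentropic state `θ = K ρ^{2/3} = K c²`,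
`∂ₗ∂ᵢθ = 2K ∂ₗc ∂ᵢc + 2K c ∂ₗ∂ᵢc`.
-/

noncomputable section

namespace Summit.AtomisticToContinuum.HydrodynamicLimit.Theorems

open Set Filter Topology MeasureTheory
open scoped ContDiff
open Literature.MathematicalPhysics.KineticTheory Literature.Analysis.FunctionSpaces

/-- **`∂ₗ∂ᵢρ = 6 c ∂ₗc ∂ᵢc + 3 c² ∂ₗ∂ᵢc`** for the cube root `c = ρ^{1/3}` of the density slice of a
classical solution. [folklore] -/
theorem isentropic_partialDeriv2_density :
    ∀ {σ T : ℝ} {ρ θ : ℝ → T3 → ℝ} {u : ℝ → T3 → V3}, IsHardSphereEulerSolution σ T ρ u θ →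
      ∀ {t : ℝ}, t ∈ Ico 0 T → ∀ (x : T3) (i l : Fin 3),
        Torus.partialDeriv l (Torus.partialDeriv i (ρ t)) x =
          6 * ρ t x ^ (1 / 3 : ℝ) * Torus.partialDeriv l (fun y => ρ t y ^ (1 / 3 : ℝ)) x *
              Torus.partialDeriv i (fun y => ρ t y ^ (1 / 3 : ℝ)) x +
            3 * (ρ t x ^ (1 / 3 : ℝ)) ^ 2 *
              Torus.partialDeriv l (Torus.partialDeriv i (fun y => ρ t y ^ (1 / 3 : ℝ))) x := by
  intro σ T ρ θ u hE t ht x i l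
  have hcs : Torus.IsSmooth (fun y => ρ t y ^ (1 / 3 : ℝ)) :=
    (isentropic_cuberoot_smooth hE).isSmooth_slice ht
  have hc1 : Torus.IsContDiff 1 (fun y => ρ t y ^ (1 / 3 : ℝ)) := hcs.isContDiff (by simp)
  have hdc1 : Torus.IsContDiff 1 (Torus.partialDeriv i (fun y => ρ t y ^ (1 / 3 : ℝ))) :=
    (hcs.partialDeriv i).isContDiff (by simp)
  -- the first-order identity as an identity of functions
  have hfun : Torus.partialDeriv i (ρ t) =
      fun y => (3 * (ρ t y ^ (1 / 3 : ℝ)) ^ 2) * Torus.partialDeriv i (fun z => ρ t z ^ (1 / 3 : ℝ)) y :=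
    funext fun y => isentropic_partialDeriv_density hE ht y i
  have hsq : Torus.IsContDiff 1 (fun y => 3 * (ρ t y ^ (1 / 3 : ℝ)) ^ 2) :=
    ((Torus.isContDiff_const (3 : ℝ)).mul (hc1.pow 2) :)
  rw [hfun, Torus.partialDeriv_mul hsq hdc1 l x]
  -- `∂ₗ (3 c²) = 6 c ∂ₗ c`
  have hd : Torus.partialDeriv l (fun y => 3 * (ρ t y ^ (1 / 3 : ℝ)) ^ 2) x =
      6 * ρ t x ^ (1 / 3 : ℝ) * Torus.partialDeriv l (fun y => ρ t y ^ (1 / 3 : ℝ)) x := by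
    have h := ((hasDerivAt_coordLine hc1 x l).pow 2).const_mul (3 : ℝ)
    rw [partialDeriv_eq_of_hasDerivAt h]
    simp only [zero_smul, Torus.proj_zero, add_zero]
    norm_num; ring
  rw [hd]; ring

/-- **`∂ₗ∂ᵢθ = 2K ∂ₗc ∂ᵢc + 2K c ∂ₗ∂ᵢc`** for an isentropic state `θ = K ρ^{2/3}` of a classical
solution, `c = ρ^{1/3}`. [folklore] -/
theorem isentropic_partialDeriv2_temperature :
    ∀ {σ T K : ℝ} {ρ θ : ℝ → T3 → ℝ} {u : ℝ → T3 → V3}, IsHardSphereEulerSolution σ T ρ u θ → 0 < K →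
      (∀ t ∈ Ico 0 T, ∀ x, θ t x = K * ρ t x ^ (2 / 3 : ℝ)) →
      ∀ {t : ℝ}, t ∈ Ico 0 T → ∀ (x : T3) (i l : Fin 3),
        Torus.partialDeriv l (Torus.partialDeriv i (θ t)) x =
          2 * K * Torus.partialDeriv l (fun y => ρ t y ^ (1 / 3 : ℝ)) x *
              Torus.partialDeriv i (fun y => ρ t y ^ (1 / 3 : ℝ)) x +
            2 * K * ρ t x ^ (1 / 3 : ℝ) *
              Torus.partialDeriv l (Torus.partialDeriv i (fun y => ρ t y ^ (1 / 3 : ℝ))) x := by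
  intro σ T K ρ θ u hE hK hisen t ht x i l
  have hcs : Torus.IsSmooth (fun y => ρ t y ^ (1 / 3 : ℝ)) :=
    (isentropic_cuberoot_smooth hE).isSmooth_slice ht
  have hc1 : Torus.IsContDiff 1 (fun y => ρ t y ^ (1 / 3 : ℝ)) := hcs.isContDiff (by simp)
  have hdc1 : Torus.IsContDiff 1 (Torus.partialDeriv i (fun y => ρ t y ^ (1 / 3 : ℝ))) :=
    (hcs.partialDeriv i).isContDiff (by simp)
  have hfun : Torus.partialDeriv i (θ t) =
      fun y => (2 * K * ρ t y ^ (1 / 3 : ℝ)) * Torus.partialDeriv i (fun z => ρ t z ^ (1 / 3 : ℝ)) y :=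
    funext fun y => isentropic_partialDeriv_temperature hE hK hisen ht y i
  have hlin : Torus.IsContDiff 1 (fun y => 2 * K * ρ t y ^ (1 / 3 : ℝ)) :=
    ((Torus.isContDiff_const (2 * K : ℝ)).mul hc1 :)
  rw [hfun, Torus.partialDeriv_mul hlin hdc1 l x]
  have hd : Torus.partialDeriv l (fun y => 2 * K * ρ t y ^ (1 / 3 : ℝ)) x =
      2 * K * Torus.partialDeriv l (fun y => ρ t y ^ (1 / 3 : ℝ)) x := by
    have h := (hasDerivAt_coordLine hc1 x l).const_mul (2 * K : ℝ)
    rw [partialDeriv_eq_of_hasDerivAt h]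
  rw [hd]; ring

end Summit.AtomisticToContinuum.HydrodynamicLimit.Theorems

end
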